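import Summits.QuantumFields.YangMills.Theorems.NPointIsotropy.Negative.TieLoadBearing

/-!
# Negative results on `PencilRigidity.NPointIsotropy`, IX (boundary lemma): degree two of the conclusion is free

Ninth file of the standing disprover's analysis of crux stmt-QuantumFields-11686 (refuter, cdisprove, cycle 2).
The radial-kernel hypothesis ALONE gives the conclusion of the crux in degree `2` — for EVERY linear isometry of
`ℝ⁴`, not only the planar rotations — by the isometry-invariance of Lebesgue measure on `(ℝ⁴)²`:
`𝔖₂(R·F) = ∫ K(x₀−x₁) F(R⁻¹x) dx = ∫ K(R(y₀−y₁)) F(y) dy = ∫ K(y₀−y₁) F(y) dy = 𝔖₂(F)`.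
Together with degree `0` (trivial) and degree `1` (`𝔖₁ = κ·dx` from translation invariance, `Disproof.lean` §6a)
this is the exact content of "the n-point step starts at `n = 3`"; by file VII every non-coincident 3-point
configuration is frame-separated, by files I–V and VIII the first junk lives in degree `4`.
-/

noncomputable section

namespace Summit.QuantumFields.YangMills.Theorems.NPointIsotropy.Negative

open scoped SchwartzMap
open MeasureTheory
open Literature.MathematicalPhysics.QuantumLattice Literature.MathematicalPhysics.AQFT
open Summit.QuantumFields.YangMills.Theorems.CurvatureBoostCovariance.Negative (isOffDiagonal_linActMulti)

/-- Change of variables by an isometry acting diagonally on two-point configurations (Lebesgue measure on `(ℝ⁴)²`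
is invariant). [folklore] -/
theorem integral_comp_isometry_two (R : E4 ≃ₗᵢ[ℝ] E4) (g : (Fin 2 → E4) → ℂ) :
    ∫ x : Fin 2 → E4, g (fun i => R.symm (x i)) = ∫ y : Fin 2 → E4, g y := by
  have hmp : MeasurePreserving (fun (x : Fin 2 → E4) (i : Fin 2) => R.symm (x i)) :=
    volume_preserving_pi fun _ => R.symm.measurePreserving
  have hme : MeasurableEmbedding (fun (x : Fin 2 → E4) (i : Fin 2) => R.symm (x i)) :=
    (MeasurableEquiv.piCongrRight fun _ : Fin 2 => R.symm.toHomeomorph.toMeasurableEquiv).measurableEmbedding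
  exact hmp.integral_comp hme g

/-- **Degree two of the conclusion is free.** A one-species family with the radial two-point kernel is invariant
on `⁰𝒮` in degree `2` under EVERY linear isometry of `ℝ⁴`. [folklore] -/
theorem radialKernel_invariant_two {S₁ : SchwingerFamily E4} (hK : RadialKernel S₁) (R : E4 ≃ₗᵢ[ℝ] E4)
    (F : 𝓢((Fin 2 → E4), ℂ)) (hF : IsOffDiagonal F) : S₁ 2 (linActMulti R F) = S₁ 2 F := by
  obtain ⟨K, -, hrad, hrep⟩ := hK
  rw [(hrep _ (isOffDiagonal_linActMulti hF R)).2, (hrep _ hF).2]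
  have hpt : (fun x : Fin 2 → E4 => (K (x 0 - x 1) : ℂ) * (linActMulti R F) x) =
      fun x : Fin 2 → E4 => (fun y : Fin 2 → E4 => (K (y 0 - y 1) : ℂ) * F y) (fun i => R.symm (x i)) := by
    funext x
    simp only [linActMulti_apply]
    congr 2
    rw [← map_sub]
    by_cases h : x 0 - x 1 = 0
    · rw [h, map_zero]
    · exact (hrad R.symm _ h).symm
  rw [hpt]
  exact integral_comp_isometry_two R (fun y : Fin 2 → E4 => (K (y 0 - y 1) : ℂ) * F y)

/-- In particular the PLANAR conclusion of the crux holds in degree `2` from the kernel hypothesis alone. -/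
theorem radialKernel_planar_two {S₁ : SchwingerFamily E4} (hK : RadialKernel S₁) (R : E4 ≃ₗᵢ[ℝ] E4)
    (_hdet : LinearMap.det (R.toLinearEquiv : E4 →ₗ[ℝ] E4) = 1)
    (_h2 : R (EuclideanSpace.single 2 1) = EuclideanSpace.single 2 1)
    (_h3 : R (EuclideanSpace.single 3 1) = EuclideanSpace.single 3 1)
    (F : 𝓢((Fin 2 → E4), ℂ)) (hF : IsOffDiagonal F) : S₁ 2 (linActMulti R F) = S₁ 2 F :=
  radialKernel_invariant_two hK R F hF

end Summit.QuantumFields.YangMills.Theorems.NPointIsotropy.Negative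

end
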